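import Mathlib
import Literature.Computability.Complexity.CNF
import Summits.PneNP.PneNP.Theorems.OverlapGapAlgebraSolvableImpliesStableSectionUnsatRegime

/-!
# PneNP / OverlapGapAlgebra — crux `SolvableImpliesStableSection` (stmt-PneNP-2463):
# calibration — the crux is vacuous above the FIRST-MOMENT threshold `α ≥ 2^k log 2`

Support for crux `stmt-PneNP-2463` (`Summit.PneNP.PneNP.Theses.OverlapGapAlgebra.SolvableImpliesStableSection`).
The line-`Sketch` calibration `solvableImpliesStableSection_hyp_false_of_density_ge` kills the hypothesis of
the crux at clause density `α ≥ 2^k` by the first moment `Pr[sat] ≤ 2^n (1 - 2^{-k})^m`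
(`ur_sat_fraction_le`). The same first moment is sharp up to the classical threshold: it tends to `0`
exactly when `log 2 + α log(1 - 2^{-k}) < 0`, i.e. `α > log 2 / (-log(1 - 2^{-k}))` (`≈ 2^k log 2`;
`5.19, 10.74, 21.8` for `k = 3, 4, 5` against `8, 16, 32`). This file records that sharpening:

* `sissFM_no_solver` — under `log 2 + α log(1 - 2^{-k}) < 0`, NO map (efficient or not) solves
  `F_k(n, ⌊α n⌋₊)` with probability `≥ ε` eventually;
* `sissFM_hyp_false_of_firstMoment` — hence the hypothesis of `SolvableImpliesStableSection` is false there
  (exact hypothesis shape), so the crux holds vacuously;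
* `sissFM_hyp_false_of_density_ge_log_two` — the explicit sufficient condition `2^k log 2 ≤ α`
  (`log(1 - p) < -p`).
So the contentful density strip of the crux is `α < 2^k log 2` (the first-moment upper bound on the
satisfiability threshold, itself `2^k log 2 - (1 + log 2)/2 + o_k(1)` by Ding–Sly–Sun), not `α < 2^k`.
No new definitions; axioms `propext`, `Classical.choice`, `Quot.sound`.
-/

set_option linter.dupNamespace false -- `Summit.PneNP.PneNP.…`: summit = sub-problem (D-0017)

namespace Summit.PneNP.PneNP.Theorems

open Finset Filter
open scoped Classical

/-- **No map succeeds above the first-moment threshold.** If `log 2 + α·log(1 - 2^{-k}) < 0`, then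
for every `f` (read in the crux's input/output format) and every `ε > 0`, eventually in `n` the fraction
of instances of `F_k(n, ⌊α n⌋₊)` solved by `f` is `< ε`: solved ⇒ satisfiable, and
`Pr[sat] ≤ 2^n (1 - 2^{-k})^m ≤ (1 - 2^{-k})^{-1} · exp(n (log 2 + α log(1 - 2^{-k}))) → 0`. -/
theorem sissFM_no_solver (k : ℕ) (α : ℝ)
    (hfm : Real.log 2 + α * Real.log (1 - (1 / 2 : ℝ) ^ k) < 0) (f : List Bool → List Bool)
    (ε : ℝ) (hε : 0 < ε) :
    ∀ᶠ n : ℕ in Filter.atTop, ∀ m : ℕ, m = ⌊α * n⌋₊ →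
      ((Finset.univ.filter fun Φ : Fin m → Fin k → Fin n × Bool => ∀ i, ∃ j,
          (f (Literature.Computability.Complexity.encodingCNF.encode (List.ofFn fun a =>
            List.ofFn fun b => (((Φ a b).1 : ℕ), (Φ a b).2)))).getD (Φ i j).1 false =
              (Φ i j).2).card : ℝ) / Fintype.card (Fin m → Fin k → Fin n × Bool) < ε := by
  set p : ℝ := (1 / 2 : ℝ) ^ k with hp
  have hp0 : 0 < p := by positivity
  have hp1 : p ≤ 1 := by rw [hp]; exact pow_le_one₀ (by norm_num) (by norm_num)
  -- `1 - p > 0`: otherwise `log (1 - p) = 0` contradicts `hfm`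
  have h1p : 0 < 1 - p := by
    rcases lt_or_eq_of_le hp1 with h | h
    · linarith
    · exfalso
      rw [h, sub_self, Real.log_zero, mul_zero, add_zero] at hfm
      exact absurd hfm (not_lt.2 (Real.log_nonneg one_le_two))
  have hlog : Real.log (1 - p) ≤ 0 := Real.log_nonpos (by linarith) (by linarith)
  set r : ℝ := Real.exp (Real.log 2 + α * Real.log (1 - p)) with hr
  have hr0 : 0 < r := Real.exp_pos _
  have hr1 : r < 1 := by rw [hr]; exact Real.exp_lt_one_iff.2 hfm
  have hgeo : Filter.Tendsto (fun n : ℕ => (1 - p)⁻¹ * r ^ n) Filter.atTop (nhds 0) := by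
    have := tendsto_pow_atTop_nhds_zero_of_lt_one hr0.le hr1
    simpa using this.const_mul ((1 - p)⁻¹)
  filter_upwards [hgeo.eventually (gt_mem_nhds hε), Filter.eventually_ge_atTop 1] with n hsmall hn1
  intro m hm
  -- solved ⇒ satisfiable
  have hsub : ((Finset.univ.filter fun Φ : Fin m → Fin k → Fin n × Bool => ∀ i, ∃ j,
        (f (Literature.Computability.Complexity.encodingCNF.encode (List.ofFn fun a =>
          List.ofFn fun b => (((Φ a b).1 : ℕ), (Φ a b).2)))).getD (Φ i j).1 false =
            (Φ i j).2).card : ℝ)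
      ≤ (((univ : Finset (Fin m → Fin k → Fin n × Bool)).filter fun Φ =>
          ∃ σ : Fin n → Bool, ∀ i, ∃ j, σ (Φ i j).1 = (Φ i j).2).card : ℝ) := by
    exact_mod_cast Finset.card_le_card fun Φ hΦ => by
      simp only [mem_filter, mem_univ, true_and] at hΦ ⊢
      exact ⟨fun v => (f (Literature.Computability.Complexity.encodingCNF.encode (List.ofFn fun a =>
          List.ofFn fun b => (((Φ a b).1 : ℕ), (Φ a b).2)))).getD v false, hΦ⟩
  have hcard : (0 : ℝ) < Fintype.card (Fin m → Fin k → Fin n × Bool) := by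
    haveI : Nonempty (Fin n × Bool) := ⟨(⟨0, hn1⟩, false)⟩
    exact_mod_cast Fintype.card_pos
  refine lt_of_le_of_lt ((div_le_div_of_nonneg_right hsub hcard.le).trans
    (Summit.PneNP.PneNP.Cruxes.SolvableImpliesStableSection.Sketch.ur_sat_fraction_le n k m hn1))
    (lt_of_le_of_lt ?_ hsmall)
  -- `2^n (1-p)^m ≤ (1-p)⁻¹ r^n`, i.e. `m log(1-p) ≤ (α n - 1) log(1-p)`
  have hmge : α * n - 1 ≤ (m : ℝ) := by
    rw [hm]; have := Nat.lt_floor_add_one (α * n); linarith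
  have h1 : (1 - p) ^ m = Real.exp (m * Real.log (1 - p)) := by
    rw [Real.exp_nat_mul, Real.exp_log h1p]
  have h2 : (2 : ℝ) ^ n = Real.exp (n * Real.log 2) := by
    rw [Real.exp_nat_mul, Real.exp_log two_pos]
  have h3 : r ^ n = Real.exp (n * (Real.log 2 + α * Real.log (1 - p))) := by
    rw [hr, ← Real.exp_nat_mul]
  have h4 : (1 - p)⁻¹ = Real.exp (-Real.log (1 - p)) := by
    rw [Real.exp_neg, Real.exp_log h1p]
  have key : (m : ℝ) * Real.log (1 - p) ≤ (α * n - 1) * Real.log (1 - p) :=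
    mul_le_mul_of_nonpos_right hmge hlog
  calc (2 : ℝ) ^ n * (1 - (1 / 2 : ℝ) ^ k) ^ m = (2 : ℝ) ^ n * (1 - p) ^ m := by rw [hp]
    _ = Real.exp (n * Real.log 2 + m * Real.log (1 - p)) := by rw [h1, h2, ← Real.exp_add]
    _ ≤ Real.exp (-Real.log (1 - p) + n * (Real.log 2 + α * Real.log (1 - p))) :=
        Real.exp_le_exp.2 (by linarith [key])
    _ = (1 - p)⁻¹ * r ^ n := by rw [h4, h3, ← Real.exp_add]

/-- **The crux is vacuously true above the first-moment threshold:** if `log 2 + α log(1 - 2^{-k}) < 0`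
then the hypothesis of `SolvableImpliesStableSection` (stated in its exact shape; the map is not even
required to be polynomial-time for this) is FALSE at `(k, α)`. Sharpens the line-`Sketch` calibration
`solvableImpliesStableSection_hyp_false_of_density_ge` (`α ≥ 2^k`) to the classical first-moment bound
`α > log 2 / (-log(1 - 2^{-k})) ≈ 2^k log 2`. -/
theorem sissFM_hyp_false_of_firstMoment (k : ℕ) (α : ℝ)
    (hfm : Real.log 2 + α * Real.log (1 - (1 / 2 : ℝ) ^ k) < 0) :
    ¬ (∃ f : List Bool → List Bool, Literature.Computability.Complexity.IsPolyTime f ∧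
      ∃ ε : ℝ, 0 < ε ∧ ∃ᶠ n : ℕ in Filter.atTop, ∀ m : ℕ, m = ⌊α * n⌋₊ → ε ≤
        ((Finset.univ.filter fun Φ : Fin m → Fin k → Fin n × Bool => ∀ i, ∃ j,
          (f (Literature.Computability.Complexity.encodingCNF.encode (List.ofFn fun a =>
            List.ofFn fun b => (((Φ a b).1 : ℕ), (Φ a b).2)))).getD (Φ i j).1 false =
              (Φ i j).2).card : ℝ) / Fintype.card (Fin m → Fin k → Fin n × Bool)) := by
  rintro ⟨f, -, ε, hε, hfreq⟩
  have hev := sissFM_no_solver k α hfm f ε hε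
  refine (hfreq.and_eventually hev).exists.elim fun n hn => ?_
  obtain ⟨h1, h2⟩ := hn
  exact absurd (h1 _ rfl) (not_le.2 (h2 _ rfl))

/-- **Explicit form: the crux is vacuously true at every density `α ≥ 2^k log 2`** (for `k ≥ 1`),
since `log(1 - p) < -p` for `0 < p < 1` gives `log 2 + α log(1 - 2^{-k}) < log 2 - α 2^{-k} ≤ 0`. -/
theorem sissFM_hyp_false_of_density_ge_log_two (k : ℕ) (hk : 1 ≤ k) (α : ℝ)
    (hα : (2 : ℝ) ^ k * Real.log 2 ≤ α) :
    ¬ (∃ f : List Bool → List Bool, Literature.Computability.Complexity.IsPolyTime f ∧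
      ∃ ε : ℝ, 0 < ε ∧ ∃ᶠ n : ℕ in Filter.atTop, ∀ m : ℕ, m = ⌊α * n⌋₊ → ε ≤
        ((Finset.univ.filter fun Φ : Fin m → Fin k → Fin n × Bool => ∀ i, ∃ j,
          (f (Literature.Computability.Complexity.encodingCNF.encode (List.ofFn fun a =>
            List.ofFn fun b => (((Φ a b).1 : ℕ), (Φ a b).2)))).getD (Φ i j).1 false =
              (Φ i j).2).card : ℝ) / Fintype.card (Fin m → Fin k → Fin n × Bool)) := by
  set p : ℝ := (1 / 2 : ℝ) ^ k with hp
  have hp0 : 0 < p := by positivity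
  have hp1 : p < 1 := by rw [hp]; exact pow_lt_one₀ (by norm_num) (by norm_num) (by omega)
  have hlog2 : 0 < Real.log 2 := Real.log_pos one_lt_two
  have h2k : (0 : ℝ) < (2 : ℝ) ^ k := by positivity
  have hαpos : 0 < α := lt_of_lt_of_le (by positivity) hα
  -- `log(1 - p) < -p`
  have hlt : Real.log (1 - p) < -p := by
    have h := Real.log_lt_sub_one_of_pos (by linarith : 0 < 1 - p) (by linarith : 1 - p ≠ 1)
    linarith
  -- `α p ≥ log 2`
  have hpk : p * (2 : ℝ) ^ k = 1 := by
    rw [hp, one_div, inv_pow, inv_mul_cancel₀ h2k.ne']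
  have hαp : Real.log 2 ≤ α * p := by
    have := mul_le_mul_of_nonneg_right hα hp0.le
    calc Real.log 2 = (2 : ℝ) ^ k * Real.log 2 * p := by
          rw [mul_comm ((2 : ℝ) ^ k), mul_assoc, mul_comm ((2 : ℝ) ^ k) p, hpk, mul_one]
      _ ≤ α * p := this
  refine sissFM_hyp_false_of_firstMoment k α ?_
  have : α * Real.log (1 - p) < α * (-p) := mul_lt_mul_of_pos_left hlt hαpos
  show Real.log 2 + α * Real.log (1 - p) < 0
  linarith

end Summit.PneNP.PneNP.Theorems
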